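import Summits.HubbardSuperconductivity.HubbardSuperconductivity.Theorems.AnisotropyChordAmplitudeStableHolds
import Literature.Combinatorics.StablePolynomials.NegativeCorrelation

/-!
# Route `AnisotropyChord`: the amplitude law of an easy-plane XXZ sector ground state is PAIRWISE
# NEGATIVELY CORRELATED (memo ROTOR-THEORY-6 §63 (iii), the negative-dependence layer made concrete)

For every finite CONNECTED graph, `Δ ∈ [−1,1]`, every sector ground state `ψ` of
`H(Δ) = xxzHamiltonian 1 G (−1) Δ` and sites `x ≠ y`:

  `(Σ_{σ : σ x = 0, σ y = 0} |ψ σ|) · (Σ_σ |ψ σ|) ≤ (Σ_{σ : σ x = 0} |ψ σ|) · (Σ_{σ : σ y = 0} |ψ σ|)`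

(`xxz_groundState_amplitude_pairwise_negCorr`): under the amplitude law `α(σ) ∝ |ψ(σ)|` the
occupations (index `0` = up spin = hard-core boson present, the convention of Theorem S) of two distinct
sites are negatively correlated — `P(x, y occupied) ≤ P(x occupied) P(y occupied)`.  By the algebraic
identity `P(AᶜBᶜ) − P(Aᶜ)P(Bᶜ) = P(AB) − P(A)P(B)` the same holds for the value `1`
(`xxz_groundState_amplitude_pairwise_negCorr_one`).

Proof: by sector Perron–Frobenius (`xxz_sector_perron_pos`, connected graph) `ψ = c • ψ₀` with
`ψ₀ ≥ 0` a sector ground vector; Theorem S (`GroundStateStability_proof`, closed crux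
stmt-AtomisticToContinuum-9672, zero fields) makes the occupation polynomial `Σ_S ψ₀(1⁰_S) z^S`
zero-free on `ℍ^V`, i.e. the REAL coefficient family `S ↦ ψ₀(1⁰_S)` is strongly Rayleigh, and
Borcea–Brändén–Liggett's pairwise negative correlation (`multiAffine_pairwise_negCorr`, Literature
`StablePolynomials/NegativeCorrelation`, PROVED there) applies; finally `|ψ σ| = |c| ψ₀(σ)`.
Theory seat `hubbard-h0-rotor-theory-1`.  No definition is introduced.
-/

set_option linter.dupNamespace false

noncomputable section

namespace Summit.HubbardSuperconductivity.HubbardSuperconductivity.Theorems.AnisotropyChord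

open Matrix Complex Finset
open scoped ComplexOrder
open Literature.MathematicalPhysics.QuantumLattice Literature.Probability.LatticeModels
open Literature.Combinatorics.StablePolynomials (multiAffine_pairwise_negCorr)
open Summit.AtomisticToContinuum.BoseEinsteinCondensation.Cruxes.GroundStateStability.StableConeVariationalSelection
  (coneSel_indicator_filter_eq coneSel_indicator_eq_iff)

variable {V : Type} [Fintype V] [DecidableEq V]

omit [Fintype V] in
/-- `1⁰_S x = 0 ↔ x ∈ S` for the occupation indicator `1⁰_S` (value `0` on `S`, `1` off `S`). [folklore] -/
theorem ite_fin_two_eq_zero_iff (S : Finset V) (x : V) :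
    ((if x ∈ S then (0 : Fin 2) else 1) = 0) ↔ x ∈ S := by
  by_cases hx : x ∈ S <;> simp [hx]

/-- Transport of filtered sums from occupation indicators to configurations. [folklore] -/
theorem sum_filter_indicator_eq_sum_filter_config (F : (V → Fin 2) → ℝ) (P : Finset V → Prop)
    (Q : (V → Fin 2) → Prop) [DecidablePred P] [DecidablePred Q]
    (hPQ : ∀ S : Finset V, P S ↔ Q (fun i => if i ∈ S then 0 else 1)) :
    (∑ S ∈ Finset.univ.filter P, F (fun i => if i ∈ S then 0 else 1)) =
      ∑ σ ∈ Finset.univ.filter Q, F σ := by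
  let e : Finset V ≃ (V → Fin 2) :=
    { toFun := fun S i => if i ∈ S then 0 else 1
      invFun := fun σ => Finset.univ.filter fun x => σ x = 0
      left_inv := fun S => ((coneSel_indicator_eq_iff S _).1 rfl).symm
      right_inv := fun σ => coneSel_indicator_filter_eq σ }
  refine Finset.sum_equiv e (fun S => ?_) (fun S _ => rfl)
  simp only [Finset.mem_filter, Finset.mem_univ, true_and]
  exact hPQ S

/-- **Pairwise negative correlation of the amplitude law (value `0` = occupied).**  For a connected
graph, `Δ ∈ [−1, 1]`, a sector ground state `ψ` of `H(Δ)` and sites `x ≠ y`: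
`(Σ_{σx=0,σy=0} |ψ|)(Σ |ψ|) ≤ (Σ_{σx=0} |ψ|)(Σ_{σy=0} |ψ|)`.  Memo ROTOR-THEORY-6 §63 (iii);
Borcea–Brändén–Liggett via Theorem S. [folklore] -/
theorem xxz_groundState_amplitude_pairwise_negCorr (G : SimpleGraph V) [DecidableRel G.Adj]
    (hG : G.Connected) {Δ : ℝ} (h1 : -1 ≤ Δ) (h2 : Δ ≤ 1) {M : ℝ} {ψ : TensorIndex V 2 → ℂ}
    (hψ : IsSectorGroundState G Δ M ψ) {x y : V} (hxy : x ≠ y) :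
    (∑ σ ∈ Finset.univ.filter (fun σ : V → Fin 2 => σ x = 0 ∧ σ y = 0), ‖ψ σ‖) * (∑ σ, ‖ψ σ‖) ≤
      (∑ σ ∈ Finset.univ.filter (fun σ : V → Fin 2 => σ x = 0), ‖ψ σ‖) *
        (∑ σ ∈ Finset.univ.filter (fun σ : V → Fin 2 => σ y = 0), ‖ψ σ‖) := by
  obtain ⟨hψK, hψ1, hHψ⟩ := hψ
  have hψ0 : ψ ≠ 0 := by
    intro h
    rw [h, dotProduct_zero] at hψ1
    exact zero_ne_one hψ1
  obtain ⟨W, hW, hMW⟩ := exists_weight_of_mem_spinZSector hψK hψ0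
  -- the positive Perron ground vector of the sector and `ψ = c • ψ₀`
  obtain ⟨ψ₀, hψ₀K, hψ₀0, hψ₀nn, -, -, hHψ₀, huniq⟩ := xxz_sector_perron_pos G hG Δ W hW
  rw [← hMW] at hψ₀K hHψ₀ huniq
  obtain ⟨c, hc⟩ := huniq ψ hψK hHψ
  -- Theorem S for `ψ₀` (zero fields): the real family `S ↦ ψ₀(1⁰_S)` is strongly Rayleigh
  have hGS := Summit.AtomisticToContinuum.BoseEinsteinCondensation.Theorems.GroundStateStability_proof
    V G hG Δ (fun _ => (0 : ℝ)) (abs_le.mpr ⟨h1, h2⟩) M ψ₀ hψ₀K hψ₀0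
  simp only [Complex.ofReal_zero, zero_smul, Finset.sum_const_zero, add_zero] at hGS
  have hst := hGS hHψ₀
  have hreal : ∀ σ, (((ψ₀ σ).re : ℝ) : ℂ) = ψ₀ σ := fun σ =>
    Complex.ext (by simp) (by simp [(hψ₀nn σ).2])
  have key := multiAffine_pairwise_negCorr (σ := V)
    (fun S : Finset V => (ψ₀ (fun i => if i ∈ S then 0 else 1)).re)
    (Or.inr fun z hz => by simpa only [hreal] using hst z hz) hxy
  -- `‖ψ σ‖ = ‖c‖ · Re ψ₀ σ`
  have hnorm : ∀ σ, ‖ψ σ‖ = ‖c‖ * (ψ₀ σ).re := by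
    intro σ
    rw [hc, Pi.smul_apply, smul_eq_mul, norm_mul, ← hreal σ, Complex.norm_real, Complex.ofReal_re,
      Real.norm_of_nonneg (hψ₀nn σ).1]
  -- transport `key` from indicators to configurations
  have h12 := sum_filter_indicator_eq_sum_filter_config (fun σ => (ψ₀ σ).re)
    (fun S => x ∈ S ∧ y ∈ S) (fun σ => σ x = 0 ∧ σ y = 0)
    (fun S => by simp only [ite_fin_two_eq_zero_iff])
  have h1 := sum_filter_indicator_eq_sum_filter_config (fun σ => (ψ₀ σ).re)
    (fun S => x ∈ S) (fun σ => σ x = 0) (fun S => by simp only [ite_fin_two_eq_zero_iff])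
  have h2 := sum_filter_indicator_eq_sum_filter_config (fun σ => (ψ₀ σ).re)
    (fun S => y ∈ S) (fun σ => σ y = 0) (fun S => by simp only [ite_fin_two_eq_zero_iff])
  have h0 := sum_filter_indicator_eq_sum_filter_config (fun σ => (ψ₀ σ).re)
    (fun _ => True) (fun _ => True) (fun S => Iff.rfl)
  rw [Finset.filter_true_of_mem fun _ _ => trivial, Finset.filter_true_of_mem fun _ _ => trivial] at h0
  rw [h12, h1, h2, h0] at key
  simp only [hnorm, ← Finset.mul_sum]
  have hcc : 0 ≤ ‖c‖ * ‖c‖ := mul_nonneg (norm_nonneg _) (norm_nonneg _)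
  nlinarith [mul_le_mul_of_nonneg_left key hcc]

/-- The same for the value `1` (down spin / empty site): pairwise negative correlation is symmetric
under complementing both events, `P(AᶜBᶜ)·1 − P(Aᶜ)P(Bᶜ) = P(AB)·1 − P(A)P(B)` in unnormalised form.
[folklore] -/
theorem xxz_groundState_amplitude_pairwise_negCorr_one (G : SimpleGraph V) [DecidableRel G.Adj]
    (hG : G.Connected) {Δ : ℝ} (h1 : -1 ≤ Δ) (h2 : Δ ≤ 1) {M : ℝ} {ψ : TensorIndex V 2 → ℂ}
    (hψ : IsSectorGroundState G Δ M ψ) {x y : V} (hxy : x ≠ y) :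
    (∑ σ ∈ Finset.univ.filter (fun σ : V → Fin 2 => σ x = 1 ∧ σ y = 1), ‖ψ σ‖) * (∑ σ, ‖ψ σ‖) ≤
      (∑ σ ∈ Finset.univ.filter (fun σ : V → Fin 2 => σ x = 1), ‖ψ σ‖) *
        (∑ σ ∈ Finset.univ.filter (fun σ : V → Fin 2 => σ y = 1), ‖ψ σ‖) := by
  have key := xxz_groundState_amplitude_pairwise_negCorr G hG h1 h2 hψ hxy
  -- the four classes `(σ x, σ y) ∈ {0,1}²`
  have hval : ∀ (σ : V → Fin 2) (v : V), σ v = 1 ↔ ¬ σ v = 0 := fun σ v => by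
    rcases Fin.exists_fin_two.mp ⟨σ v, rfl⟩ with h | h <;> simp [h]
  set a := ∑ σ ∈ Finset.univ.filter (fun σ : V → Fin 2 => σ x = 0 ∧ σ y = 0), ‖ψ σ‖ with ha
  set b := ∑ σ ∈ Finset.univ.filter (fun σ : V → Fin 2 => σ x = 0 ∧ ¬ σ y = 0), ‖ψ σ‖ with hb
  set c := ∑ σ ∈ Finset.univ.filter (fun σ : V → Fin 2 => ¬ σ x = 0 ∧ σ y = 0), ‖ψ σ‖ with hc
  set d := ∑ σ ∈ Finset.univ.filter (fun σ : V → Fin 2 => ¬ σ x = 0 ∧ ¬ σ y = 0), ‖ψ σ‖ with hd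
  have hx0 : (∑ σ ∈ Finset.univ.filter (fun σ : V → Fin 2 => σ x = 0), ‖ψ σ‖) = a + b := by
    rw [ha, hb, ← Finset.sum_filter_add_sum_filter_not (Finset.univ.filter fun σ : V → Fin 2 => σ x = 0)
      (fun σ => σ y = 0), Finset.filter_filter, Finset.filter_filter]
  have hy0 : (∑ σ ∈ Finset.univ.filter (fun σ : V → Fin 2 => σ y = 0), ‖ψ σ‖) = a + c := by
    rw [ha, hc, ← Finset.sum_filter_add_sum_filter_not (Finset.univ.filter fun σ : V → Fin 2 => σ y = 0)
      (fun σ => σ x = 0), Finset.filter_filter, Finset.filter_filter]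
    congr 1
    · exact Finset.sum_congr (Finset.filter_congr fun σ _ => by tauto) fun _ _ => rfl
    · exact Finset.sum_congr (Finset.filter_congr fun σ _ => by tauto) fun _ _ => rfl
  have hx1 : (∑ σ ∈ Finset.univ.filter (fun σ : V → Fin 2 => σ x = 1), ‖ψ σ‖) = c + d := by
    rw [hc, hd, ← Finset.sum_filter_add_sum_filter_not (Finset.univ.filter fun σ : V → Fin 2 => σ x = 1)
      (fun σ => σ y = 0), Finset.filter_filter, Finset.filter_filter]
    congr 1
    · exact Finset.sum_congr (Finset.filter_congr fun σ _ => by rw [hval]) fun _ _ => rfl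
    · exact Finset.sum_congr (Finset.filter_congr fun σ _ => by rw [hval]) fun _ _ => rfl
  have hy1 : (∑ σ ∈ Finset.univ.filter (fun σ : V → Fin 2 => σ y = 1), ‖ψ σ‖) = b + d := by
    rw [hb, hd, ← Finset.sum_filter_add_sum_filter_not (Finset.univ.filter fun σ : V → Fin 2 => σ y = 1)
      (fun σ => σ x = 0), Finset.filter_filter, Finset.filter_filter]
    congr 1
    · exact Finset.sum_congr (Finset.filter_congr fun σ _ => by rw [hval]; tauto) fun _ _ => rfl
    · exact Finset.sum_congr (Finset.filter_congr fun σ _ => by rw [hval]; tauto) fun _ _ => rfl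
  have h11 : (∑ σ ∈ Finset.univ.filter (fun σ : V → Fin 2 => σ x = 1 ∧ σ y = 1), ‖ψ σ‖) = d := by
    rw [hd]
    exact Finset.sum_congr (Finset.filter_congr fun σ _ => by rw [hval, hval]) fun _ _ => rfl
  have htot : (∑ σ, ‖ψ σ‖) = a + b + (c + d) := by
    rw [← Finset.sum_filter_add_sum_filter_not Finset.univ (fun σ : V → Fin 2 => σ x = 0), hx0,
      ← Finset.sum_filter_add_sum_filter_not (Finset.univ.filter fun σ : V → Fin 2 => ¬ σ x = 0)
        (fun σ => σ y = 0), Finset.filter_filter, Finset.filter_filter, hc, hd]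
  rw [hx0, hy0, htot] at key
  rw [h11, hx1, hy1, htot]
  nlinarith [key]

end Summit.HubbardSuperconductivity.HubbardSuperconductivity.Theorems.AnisotropyChord
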